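import Mathlib
import HarnessLib
import Summits.HubbardSuperconductivity.HubbardSuperconductivity.Theorems.KLProgrammeKLRegimeTwoVolumeDualDefectPinned
import Summits.HubbardSuperconductivity.HubbardSuperconductivity.Theorems.KLProgrammeKLRegimeVolumeLimitLastScaleUnits
import Summits.HubbardSuperconductivity.HubbardSuperconductivity.Theses.KLProgramme

/-!
# Route `KLProgramme` — crux K3, VL child `KLRegimeVolumeLimitV17F2` (stmt-HubbardSuperconductivity-20440): THE REGISTERED STUB TEXT FROM THE
# COMMON-FRAME PINNED TWO-LEG DEFECT — UNIT-FREE (the turnkey target of ROUTE A's (A3)/(vi))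
# (cell gate-hubbard-kl, seat hubbard-kl-k3c4-p2 g9, technique «Matsubara all-U»)

k3c5-p3's `framedNestedFlowTextV17F2_of_commonFramePinnedDefect` (p557139) reads the stub text of `stub_vl_nestedFramed` from the last-scale PINNED
position-space two-leg defect of `T_L(K_L) − 𝒩_{K_L}` vs `T_{L″}(K_L) − 𝒩_{K_L}` (BOTH volumes at the coarse flow frame `K_L`, pins with a common time),
a one-volume pinned row bound `B`, and a unit partition function `IsUnit Z^{n⋆}_{L″,M}(K_L)`.  The unit is FREE
(`TwoVolumeDefect.isUnit_effPartitionFn_lastScale_eventually`, this seat's `…VolumeLimitLastScaleUnits`: all-U Matsubara bridge at frame 0 + last-scale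
frame exactness, eventually in `M`, every frame), so here is the same door WITHOUT it (re-composed from `framedNestedFlowTextV17F2_of_commonFrame_bounded`,
the dual read-out and `…TwoVolumeDualDefectPinned` rather than importing p557139, which sits in the route cone):

* **`framedNestedFlowTextV17F2_of_commonFramePinnedDefectFree`** — stub text ⟸ «per Matsubara integer ∃ L₀ δ→0 B: for `L ≥ L₀`, `L″ = b·L`, eventually in
  `M`, ∃ pins `o_c, o_f` with a common time: at every label of integer `n`, `2ε·(Σ_{t₁,ȳ}‖W_L(o_c,(t₁,o⃗_c+ȳ)) − W_{L″}(o_f,(t₁,o⃗_f+ȳ↑))‖ + Σ_{t₁, y far}‖W_{L″}(o_f,(t₁,o⃗_f+y))‖) ≤ δ L`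
  and `2ε·Σ_{t₁,y}‖W_L(o_c,(t₁,o⃗_c+y))‖ ≤ B`» — NOTHING ELSE (`W_V = sectorisedKernel β (trivialMultiplier) (T_V(K_L) − 𝒩_{K_L}) 2 ((0,0,+),(0,0,−))`);
* `volumeLimitTextV17F2_of_commonFramePinnedDefectFree`, and the by-`--workitem` closer **`KLRegimeVolumeLimitV17F2_of_commonFramePinnedDefectFree`**.

Proofs only; no definition; nothing asserts superconductivity.  References: BGM 2006 §2.4 (2.38).
-/

noncomputable section

namespace Summit.HubbardSuperconductivity.HubbardSuperconductivity.Theorems.TwoPointAssembly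

set_option linter.dupNamespace false -- summit = problem name (single-conjunct summit), D-0017

open Finset Filter Topology Complex Literature.MathematicalPhysics.QuantumLattice Literature.Probability.LatticeModels GrassmannAlgebra
open Summit.HubbardSuperconductivity.HubbardSuperconductivity.Theorems.KLRegimeSplit
open Summit.HubbardSuperconductivity.HubbardSuperconductivity.Theorems.KLProgrammeLegKernels
open Summit.HubbardSuperconductivity.HubbardSuperconductivity.Theorems.TwoVolumeDefect

/-- **THE STUB TEXT OF «cauchy v8-F2» FROM THE COMMON-FRAME PINNED TWO-LEG DEFECT, UNIT-FREE.**  See the module docstring.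
[cite: BenfattoGiulianiMastropietro2006, §2.4 (2.38)] -/
theorem framedNestedFlowTextV17F2_of_commonFramePinnedDefectFree
    (hD : ∀ (G : GeoConsts) (P : SplitConsts) (Q : EngConsts) (R : RenConsts), G.WF → P.WF → Q.WF → R.WF →
      ∃ c₅ : ℝ, 0 < c₅ ∧ ∀ c : ℝ, 0 < c → c ≤ c₅ → ∃ U₀ : ℝ, 0 < U₀ ∧
        ∀ μ ∈ klWindowC, ∀ U : ℝ, 0 < U → U ≤ U₀ → ∀ β : ℝ, klBetaMin ≤ β → β ≤ Real.exp (c / U ^ 2) →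
          ∀ K : TrigPolyC4v, klPredsV17F2.frameOK R U (nScales β) μ K →
            ∀ (Lstar : ℕ) (Mstar : ℕ → ℕ), TowerP klPredsV17F2 G P Q R β U μ K Lstar Mstar →
              ∀ n : ℤ, ∃ L₀ : ℕ, ∃ δ : ℕ → ℝ, ∃ B : ℝ, Tendsto δ atTop (𝓝 0) ∧
                ∀ (L : ℕ) [NeZero L], L₀ ≤ L → ∀ (L'' : ℕ) [NeZero L''] (b : ℕ), L'' = b * L → ∃ M₀ : ℕ, ∀ (M : ℕ) [NeZero M], M₀ ≤ M →
                  ∃ (oc : SpaceTimeIdx L M) (of : SpaceTimeIdx L'' M), of.1 = oc.1 ∧ ∀ ω : MatsubaraIdx M, matsubaraInt M ω = n →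
                    2 * imagTimeWeight β M *
                      ((∑ t₁ : ImagTimeIdx M, ∑ ybar : TorusSite 2 L,
                          ‖sectorisedKernel L M β (trivialMultiplier L M)
                                (klEffectiveAction L M β U μ (klFlowFrameU L M β U μ (nScales β + 1)) klE0 (nScales β + 1) -
                                  counterQuadratic L M β (klFlowFrameU L M β U μ (nScales β + 1))) 2
                                (![((0, 0), 0), ((0, 0), 1)] : Fin 2 → SectorLeg 1) ![oc, (t₁, oc.2 + ybar)] -
                            sectorisedKernel L'' M β (trivialMultiplier L'' M)
                                (klEffectiveAction L'' M β U μ (klFlowFrameU L M β U μ (nScales β + 1)) klE0 (nScales β + 1) -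
                                  counterQuadratic L'' M β (klFlowFrameU L M β U μ (nScales β + 1))) 2
                                (![((0, 0), 0), ((0, 0), 1)] : Fin 2 → SectorLeg 1) ![of, (t₁, of.2 + Torus.proj L'' (Torus.cRep ybar))]‖) +
                        ∑ t₁ : ImagTimeIdx M,
                          ∑ y ∈ univ.filter (fun y : TorusSite 2 L'' => Torus.proj L'' (Torus.cRep (fun i => (((y i).val : ℕ) : ZMod L))) ≠ y),
                            ‖sectorisedKernel L'' M β (trivialMultiplier L'' M)
                                (klEffectiveAction L'' M β U μ (klFlowFrameU L M β U μ (nScales β + 1)) klE0 (nScales β + 1) -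
                                  counterQuadratic L'' M β (klFlowFrameU L M β U μ (nScales β + 1))) 2
                                (![((0, 0), 0), ((0, 0), 1)] : Fin 2 → SectorLeg 1) ![of, (t₁, of.2 + y)]‖) ≤ δ L ∧
                    2 * imagTimeWeight β M *
                      ∑ t₁ : ImagTimeIdx M, ∑ y : TorusSite 2 L,
                        ‖sectorisedKernel L M β (trivialMultiplier L M)
                            (klEffectiveAction L M β U μ (klFlowFrameU L M β U μ (nScales β + 1)) klE0 (nScales β + 1) -
                              counterQuadratic L M β (klFlowFrameU L M β U μ (nScales β + 1))) 2
                            (![((0, 0), 0), ((0, 0), 1)] : Fin 2 → SectorLeg 1) ![oc, (t₁, oc.2 + y)]‖ ≤ B) :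
    ∀ (G : GeoConsts) (P : SplitConsts) (Q : EngConsts) (R : RenConsts), G.WF → P.WF → Q.WF → R.WF →
      ∃ c₅ : ℝ, 0 < c₅ ∧ ∀ c : ℝ, 0 < c → c ≤ c₅ → ∃ U₀ : ℝ, 0 < U₀ ∧
        ∀ μ ∈ klWindowC, ∀ U : ℝ, 0 < U → U ≤ U₀ → ∀ β : ℝ, klBetaMin ≤ β → β ≤ Real.exp (c / U ^ 2) →
          ∀ K : TrigPolyC4v, klPredsV17F2.frameOK R U (nScales β) μ K →
            ∀ (Lstar : ℕ) (Mstar : ℕ → ℕ), TowerP klPredsV17F2 G P Q R β U μ K Lstar Mstar →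
              ∀ n : ℤ, ∃ L₀ : ℕ, ∃ ρ : ℕ → ℝ, Tendsto ρ atTop (𝓝 0) ∧
                ∀ (L : ℕ) [NeZero L], L₀ ≤ L → ∀ (L'' : ℕ) [NeZero L''], L ∣ L'' → ∃ M₀ : ℕ, ∀ (M : ℕ) [NeZero M], M₀ ≤ M →
                  ∀ (ω : MatsubaraIdx M), matsubaraInt M ω = n → ∀ (k : TorusSite 2 L) (k'' : TorusSite 2 L''),
                    latticeMomentum L'' k'' = latticeMomentum L k →
                      ‖klSelfEnergy L M β U μ (klFlowFrameU L M β U μ (nScales β + 1)) klE0 (nScales β + 1) (ω, k) 0 -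
                          klSelfEnergy L'' M β U μ (klFlowFrameU L'' M β U μ (nScales β + 1)) klE0 (nScales β + 1) (ω, k'') 0‖ ≤ ρ L := by
  -- k3c5-p3's p557139 composition with the unit supplied by `isUnit_effPartitionFn_lastScale_eventually` at the fine volume `L″ ≥ 3`
  refine framedNestedFlowTextV17F2_of_commonFrame_bounded ?_
  intro G P Q R hG hP hQ hR
  obtain ⟨c₅, hc₅, hc⟩ := hD G P Q R hG hP hQ hR
  refine ⟨c₅, hc₅, fun c hc0 hcc => ?_⟩
  obtain ⟨U₀, hU₀, hU⟩ := hc c hc0 hcc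
  refine ⟨U₀, hU₀, fun μ hμ U hU0 hUU β hβmin hβmax K hK Lstar Mstar hT n => ?_⟩
  have hβ : 0 < β := KLRegimeSplit.pos_of_klBetaMin_le hβmin
  obtain ⟨L₀, δ, B, hδ, hDn⟩ := hU μ hμ U hU0 hUU β hβmin hβmax K hK Lstar Mstar hT n
  -- the frame sup bound from the tower
  set Kmax : ℝ := ∑ m ∈ range (nScales β + 1), R.Gfr 0 * uPow 0 U * (4 : ℝ) ^ ((((0 : ℕ) : ℤ) - 2) * (m : ℤ)) with hKmax
  refine ⟨max (max L₀ Lstar) 3, δ, Kmax + B, hδ, fun L _ hL L'' _ hdvd => ?_⟩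
  obtain ⟨b, hb⟩ := hdvd
  have hb' : L'' = b * L := by rw [hb, mul_comm]
  have hL₀ : L₀ ≤ L := ((le_max_left _ _).trans (le_max_left _ _)).trans hL
  have hLs : Lstar ≤ L := ((le_max_right _ _).trans (le_max_left _ _)).trans hL
  have hL3 : 3 ≤ L := (le_max_right _ _).trans hL
  have hL'' : 3 ≤ L'' := hL3.trans (Nat.le_of_dvd (Nat.pos_of_ne_zero (NeZero.ne L'')) ⟨b, hb⟩)
  obtain ⟨M₀, hM₀⟩ := hDn L hL₀ L'' b hb'
  obtain ⟨M₁, hM₁⟩ := isUnit_effPartitionFn_lastScale_eventually (L := L'') hβ U μ hL''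
  refine ⟨max (max M₀ (Mstar L)) M₁, fun M _ hM ω hω k k'' hk => ?_⟩
  have hMM₀ : M₀ ≤ M := ((le_max_left _ _).trans (le_max_left _ _)).trans hM
  have hMs : Mstar L ≤ M := ((le_max_right _ _).trans (le_max_left _ _)).trans hM
  have hMM₁ : M₁ ≤ M := (le_max_right _ _).trans hM
  obtain ⟨oc, of, ht, hw⟩ := hM₀ M hMM₀
  obtain ⟨hdef, hB⟩ := hw ω hω
  have hε : 0 ≤ 2 * imagTimeWeight β M := by have := imagTimeWeight_nonneg hβ.le M; positivity
  refine ⟨hM₁ M hMM₁ _, ?_, ?_⟩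
  · -- leg (i): common-frame dual read-out (frame term vanishes), rows ≤ pinned kernels
    have hi := norm_klSelfEnergy_sub_le_frame_add_dualDefect hb' hβ U μ (klFlowFrameU L M β U μ (nScales β + 1))
      (klFlowFrameU L M β U μ (nScales β + 1)) (nScales β + 1) ω 0 oc of hk
    rw [sub_self, abs_zero, zero_add] at hi
    exact hi.trans ((mul_le_mul_of_nonneg_left (dualRows_le_pinnedDefect _ _ β ω oc of ht) hε).trans hdef)
  · -- the one-volume bound: `Σ[𝒱[K]] = K(p) + Σ[𝒱[K] − 𝒩_K]`, `|K(p)| ≤ Kmax`, rows ≤ pinned kernels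
    rw [klSelfEnergy_eq_eval_add_selfEnergy_sub_counter hβ.ne' U μ _ (nScales β + 1) (ω, k) 0]
    refine (norm_add_le _ _).trans (add_le_add ?_ ?_)
    · rw [Complex.norm_real, Real.norm_eq_abs]
      exact abs_eval_klFlowFrameU_le_of_towerV17F2 hT hLs hMs le_rfl _
    · refine (norm_selfEnergy_le_dualRows hβ _ ω 0 (rows_baseIndependent_klEffectiveAction_sub_counter hβ.ne' U μ _ _ ω 0) oc k).trans ?_
      refine le_trans (mul_le_mul_of_nonneg_left ?_ hε) hB
      rw [sum_comm]
      exact sum_le_sum fun y _ => norm_phaseRow_le _ β ω oc _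

/-- **The VL child text from the common-frame pinned two-leg defect, unit-free** (∘ `volumeLimitTextV17F2_of_framedNestedFlowText`).
[cite: BenfattoGiulianiMastropietro2006, §2.4 (2.38)] -/
theorem volumeLimitTextV17F2_of_commonFramePinnedDefectFree
    (hD : ∀ (G : GeoConsts) (P : SplitConsts) (Q : EngConsts) (R : RenConsts), G.WF → P.WF → Q.WF → R.WF →
      ∃ c₅ : ℝ, 0 < c₅ ∧ ∀ c : ℝ, 0 < c → c ≤ c₅ → ∃ U₀ : ℝ, 0 < U₀ ∧
        ∀ μ ∈ klWindowC, ∀ U : ℝ, 0 < U → U ≤ U₀ → ∀ β : ℝ, klBetaMin ≤ β → β ≤ Real.exp (c / U ^ 2) →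
          ∀ K : TrigPolyC4v, klPredsV17F2.frameOK R U (nScales β) μ K →
            ∀ (Lstar : ℕ) (Mstar : ℕ → ℕ), TowerP klPredsV17F2 G P Q R β U μ K Lstar Mstar →
              ∀ n : ℤ, ∃ L₀ : ℕ, ∃ δ : ℕ → ℝ, ∃ B : ℝ, Tendsto δ atTop (𝓝 0) ∧
                ∀ (L : ℕ) [NeZero L], L₀ ≤ L → ∀ (L'' : ℕ) [NeZero L''] (b : ℕ), L'' = b * L → ∃ M₀ : ℕ, ∀ (M : ℕ) [NeZero M], M₀ ≤ M →
                  ∃ (oc : SpaceTimeIdx L M) (of : SpaceTimeIdx L'' M), of.1 = oc.1 ∧ ∀ ω : MatsubaraIdx M, matsubaraInt M ω = n →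
                    2 * imagTimeWeight β M *
                      ((∑ t₁ : ImagTimeIdx M, ∑ ybar : TorusSite 2 L,
                          ‖sectorisedKernel L M β (trivialMultiplier L M)
                                (klEffectiveAction L M β U μ (klFlowFrameU L M β U μ (nScales β + 1)) klE0 (nScales β + 1) -
                                  counterQuadratic L M β (klFlowFrameU L M β U μ (nScales β + 1))) 2
                                (![((0, 0), 0), ((0, 0), 1)] : Fin 2 → SectorLeg 1) ![oc, (t₁, oc.2 + ybar)] -
                            sectorisedKernel L'' M β (trivialMultiplier L'' M)
                                (klEffectiveAction L'' M β U μ (klFlowFrameU L M β U μ (nScales β + 1)) klE0 (nScales β + 1) -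
                                  counterQuadratic L'' M β (klFlowFrameU L M β U μ (nScales β + 1))) 2
                                (![((0, 0), 0), ((0, 0), 1)] : Fin 2 → SectorLeg 1) ![of, (t₁, of.2 + Torus.proj L'' (Torus.cRep ybar))]‖) +
                        ∑ t₁ : ImagTimeIdx M,
                          ∑ y ∈ univ.filter (fun y : TorusSite 2 L'' => Torus.proj L'' (Torus.cRep (fun i => (((y i).val : ℕ) : ZMod L))) ≠ y),
                            ‖sectorisedKernel L'' M β (trivialMultiplier L'' M)
                                (klEffectiveAction L'' M β U μ (klFlowFrameU L M β U μ (nScales β + 1)) klE0 (nScales β + 1) -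
                                  counterQuadratic L'' M β (klFlowFrameU L M β U μ (nScales β + 1))) 2
                                (![((0, 0), 0), ((0, 0), 1)] : Fin 2 → SectorLeg 1) ![of, (t₁, of.2 + y)]‖) ≤ δ L ∧
                    2 * imagTimeWeight β M *
                      ∑ t₁ : ImagTimeIdx M, ∑ y : TorusSite 2 L,
                        ‖sectorisedKernel L M β (trivialMultiplier L M)
                            (klEffectiveAction L M β U μ (klFlowFrameU L M β U μ (nScales β + 1)) klE0 (nScales β + 1) -
                              counterQuadratic L M β (klFlowFrameU L M β U μ (nScales β + 1))) 2
                            (![((0, 0), 0), ((0, 0), 1)] : Fin 2 → SectorLeg 1) ![oc, (t₁, oc.2 + y)]‖ ≤ B) :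
    VolumeLimitP2 klPredsV17F2 FinalTwoLegVolLimitEx klWindowC :=
  volumeLimitTextV17F2_of_framedNestedFlowText (framedNestedFlowTextV17F2_of_commonFramePinnedDefectFree hD)

/-- **The rev-22 VL child `KLRegimeVolumeLimitV17F2` (stmt-…-20440) from the common-frame pinned two-leg defect, unit-free** (by-`--workitem` closer shape:
hypothesis = exactly what a common-frame (A3) pass delivers). [cite: BenfattoGiulianiMastropietro2006, §2.4 (2.38)] -/
theorem KLRegimeVolumeLimitV17F2_of_commonFramePinnedDefectFree
    (hD : ∀ (G : GeoConsts) (P : SplitConsts) (Q : EngConsts) (R : RenConsts), G.WF → P.WF → Q.WF → R.WF →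
      ∃ c₅ : ℝ, 0 < c₅ ∧ ∀ c : ℝ, 0 < c → c ≤ c₅ → ∃ U₀ : ℝ, 0 < U₀ ∧
        ∀ μ ∈ klWindowC, ∀ U : ℝ, 0 < U → U ≤ U₀ → ∀ β : ℝ, klBetaMin ≤ β → β ≤ Real.exp (c / U ^ 2) →
          ∀ K : TrigPolyC4v, klPredsV17F2.frameOK R U (nScales β) μ K →
            ∀ (Lstar : ℕ) (Mstar : ℕ → ℕ), TowerP klPredsV17F2 G P Q R β U μ K Lstar Mstar →
              ∀ n : ℤ, ∃ L₀ : ℕ, ∃ δ : ℕ → ℝ, ∃ B : ℝ, Tendsto δ atTop (𝓝 0) ∧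
                ∀ (L : ℕ) [NeZero L], L₀ ≤ L → ∀ (L'' : ℕ) [NeZero L''] (b : ℕ), L'' = b * L → ∃ M₀ : ℕ, ∀ (M : ℕ) [NeZero M], M₀ ≤ M →
                  ∃ (oc : SpaceTimeIdx L M) (of : SpaceTimeIdx L'' M), of.1 = oc.1 ∧ ∀ ω : MatsubaraIdx M, matsubaraInt M ω = n →
                    2 * imagTimeWeight β M *
                      ((∑ t₁ : ImagTimeIdx M, ∑ ybar : TorusSite 2 L,
                          ‖sectorisedKernel L M β (trivialMultiplier L M)
                                (klEffectiveAction L M β U μ (klFlowFrameU L M β U μ (nScales β + 1)) klE0 (nScales β + 1) -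
                                  counterQuadratic L M β (klFlowFrameU L M β U μ (nScales β + 1))) 2
                                (![((0, 0), 0), ((0, 0), 1)] : Fin 2 → SectorLeg 1) ![oc, (t₁, oc.2 + ybar)] -
                            sectorisedKernel L'' M β (trivialMultiplier L'' M)
                                (klEffectiveAction L'' M β U μ (klFlowFrameU L M β U μ (nScales β + 1)) klE0 (nScales β + 1) -
                                  counterQuadratic L'' M β (klFlowFrameU L M β U μ (nScales β + 1))) 2
                                (![((0, 0), 0), ((0, 0), 1)] : Fin 2 → SectorLeg 1) ![of, (t₁, of.2 + Torus.proj L'' (Torus.cRep ybar))]‖) +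
                        ∑ t₁ : ImagTimeIdx M,
                          ∑ y ∈ univ.filter (fun y : TorusSite 2 L'' => Torus.proj L'' (Torus.cRep (fun i => (((y i).val : ℕ) : ZMod L))) ≠ y),
                            ‖sectorisedKernel L'' M β (trivialMultiplier L'' M)
                                (klEffectiveAction L'' M β U μ (klFlowFrameU L M β U μ (nScales β + 1)) klE0 (nScales β + 1) -
                                  counterQuadratic L'' M β (klFlowFrameU L M β U μ (nScales β + 1))) 2
                                (![((0, 0), 0), ((0, 0), 1)] : Fin 2 → SectorLeg 1) ![of, (t₁, of.2 + y)]‖) ≤ δ L ∧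
                    2 * imagTimeWeight β M *
                      ∑ t₁ : ImagTimeIdx M, ∑ y : TorusSite 2 L,
                        ‖sectorisedKernel L M β (trivialMultiplier L M)
                            (klEffectiveAction L M β U μ (klFlowFrameU L M β U μ (nScales β + 1)) klE0 (nScales β + 1) -
                              counterQuadratic L M β (klFlowFrameU L M β U μ (nScales β + 1))) 2
                            (![((0, 0), 0), ((0, 0), 1)] : Fin 2 → SectorLeg 1) ![oc, (t₁, oc.2 + y)]‖ ≤ B) :
    Summit.HubbardSuperconductivity.HubbardSuperconductivity.Theses.KLProgramme.KLRegimeVolumeLimitV17F2 := by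
  show VolumeLimitP2 klPredsV17F2 FinalTwoLegVolLimitEx klWindowC
  exact volumeLimitTextV17F2_of_commonFramePinnedDefectFree hD

end Summit.HubbardSuperconductivity.HubbardSuperconductivity.Theorems.TwoPointAssembly

end
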